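import Literature.RepresentationTheory.HeisenbergGroup.SchrodingerConjugateTorusSpherical
import Literature.RepresentationTheory.HeisenbergGroup.SchrodingerPiIsometricImplementers
import Literature.NumberTheory.Automorphic.SchwartzBruhatL2Pairing
import HarnessLib

/-!
# The spherical MATRIX COEFFICIENTS of a Darboux-conjugate torus in the Schrödinger model:
# `⟨M^j 1_{𝒪^ι}, 1_{𝒪^ι}⟩ = μ(𝒪^ι) · u^j · q^{-ι|j|/2}` for ISOMETRIC implementers

Topic `RepresentationTheory/HeisenbergGroup`; namespace `Literature.RepresentationTheory.HeisenbergGroup`.  KERNEL only (theorems;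
no definition, no named fact, no `sorry`).  Sequel of `SchrodingerConjugateTorusSpherical.lean` (§4: for `γ = transportSp T (A)`,
`A ∈ Sp_{2ι}(𝒪)`, with implementer `Γ` and ANY implementer `M` of `γ⁻¹ m(ϖ·1) γ`, `M^j 1_{𝒪^ι} ∈ ℂ^× · Γ⁻¹ 1_{(𝔭^j)^ι}`): here the
implementers are taken `L²`-ISOMETRIC (they exist: the metaplectic operators are unitary, [Weil1964, Chap. I n° 13]; tree
`exists_isometric_implementer_*`), and the MATRIX COEFFICIENTS of the spherical vector along the conjugate torus are computed:

* §1 `l2NormSq_piBallSB`, `integral_piBallSB_mul_conj_integersIndicator`, `measureReal_piPrimePowBall_pi` — `‖1_{(𝔭^m)^ι}‖² = μ((𝔭^m)^ι)`,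
  `⟨1_{(𝔭^m)^ι}, 1_{𝒪^ι}⟩ = μ((𝔭^{max(m,0)})^ι)`, and `μ((𝔭^m)^ι) = (q^{-ι})^m μ(𝒪^ι)` for the product Haar measure (kernel);
* §2 **`exists_unit_integral_zpow_apply_integersIndicator_mul_conj`** — for `Γ`, `M` as above and BOTH `L²(μ^ι)`-isometric:
  there is `u ∈ ℂ`, `|u| = 1`, with `∫ (M^j 1_{𝒪^ι}) · conj 1_{𝒪^ι} dμ^ι = μ^ι(𝒪^ι) · u^j · (q^{-ι/2})^{|j|}` for every `j ∈ ℤ`.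
  Proof: `M = c · Γ⁻¹ L_{ϖ·1} Γ` by uniqueness of implementers up to scalars, hence `M^j = c^j Γ⁻¹ L^j Γ`; `Γ 1_{𝒪^ι} = c_Γ 1_{𝒪^ι}` (the
  unramified eigenvector theorem), `L^j 1_{𝒪^ι} = 1_{(𝔭^j)^ι}`, so `⟨M^j 1, 1⟩ = c^j |c_Γ|² ⟨Γ⁻¹ 1_{𝔭^j}, Γ⁻¹ 1⟩ = c^j ⟨1_{𝔭^j}, 1⟩`
  (`Γ⁻¹` preserves the pairing: ★ `SchwartzBruhatL2Pairing`; `|c_Γ| = 1` as `Γ` is isometric) `= c^j q^{-ι max(j,0)} μ(𝒪^ι)`; and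
  `|c|² q^{-ι} μ(𝒪^ι) = ‖M 1‖² = ‖1‖² = μ(𝒪^ι)` gives `|c| = q^{ι/2}`, `u := c/|c|`.

This is the per-place content of the UNRAMIFIED LOCAL FACTOR of Rallis' inner product formula at a SPLIT place for the pair `(U(N), U(1))`
([Li1992, Thm 2.1 (27)]; [GelbartRogawski1991, §3.2]): the centre `E_w¹ ∋ z₀` acts through a Darboux conjugate of the scalar Levi torus, and the
hypothesis `hcoef` of `Li1992/RallisLocalFactorSplitUnramified` is this statement at `M = ω_v(z₀·1_N)` (cell hodgecm-mathlib, FLOOR 0, P4 (F4)).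

## References
* [MoeglinVignerasWaldspurger1987] C. Mœglin, M.-F. Vignéras, J.-L. Waldspurger, LNM 1291 (1987), Chap. 2 II.1 (A)–(B), II.6, II.10.
* [Weil1964] A. Weil, Acta Math. 111 (1964), Chap. I n° 13 (unitarity of the metaplectic operators), n° 11.
* [GelbartRogawski1991] S. Gelbart, J. Rogawski, Invent. Math. 105 (1991), §3.1 (3.1.3) p. 456, §3.2.
* [Li1992] J.-S. Li, J. reine angew. Math. 428 (1992), Thm 2.1 (27) p. 184; §5 p. 206.
-/

set_option autoImplicit false

noncomputable section

namespace Literature.RepresentationTheory.HeisenbergGroup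

open _root_.MeasureTheory Matrix ValuativeRel
open Literature.NumberTheory.Automorphic Literature.NumberTheory.Automorphic.SchwartzBruhat
open Literature.NumberTheory.GaloisRepresentations.IsNonarchimedeanLocalField
open SymplecticMatrix
open scoped NNReal ENNReal ComplexConjugate

/-! ## §1 Norms and pairings of box indicators for the product Haar measure -/

section Boxes

variable {F : Type*} [Field F] [ValuativeRel F] [TopologicalSpace F] [IsNonarchimedeanLocalField F]
  {ι : Type*} [Fintype ι] [MeasurableSpace F] [BorelSpace F] (μ : Measure F) [μ.IsAddHaarMeasure]

/-- `μ^ι((𝔭^m)^ι) = ((q⁻¹)^m μ(𝒪))^{#ι}` for the product measure. [cite: WeilBNT1967, Ch. II §2, Prop. 4] -/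
theorem measureReal_piPrimePowBall_pi (m : ℤ) :
    (Measure.pi fun _ : ι => μ).real (piPrimePowBall F ι m) =
      (((residueFieldCard F : ℝ)⁻¹) ^ m * μ.real (primePowBall F 0)) ^ Fintype.card ι := by
  haveI : SecondCountableTopology F := secondCountableTopology_localField F
  rw [piPrimePowBall, measureReal_def, Measure.pi_pi, ENNReal.toReal_prod, Finset.prod_const, Finset.card_univ]
  congr 1
  rw [← measureReal_def, LocalFieldHaar.measureReal_primePowBall μ m]

/-- `μ^ι((𝔭^m)^ι) = (q^{#ι})⁻ᵐ · μ^ι(𝒪^ι)` (as an integer power). [cite: WeilBNT1967, Ch. II §2, Prop. 4] -/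
theorem measureReal_piPrimePowBall_pi_eq_zpow_mul (m : ℤ) :
    (Measure.pi fun _ : ι => μ).real (piPrimePowBall F ι m) =
      (((residueFieldCard F : ℝ) ^ Fintype.card ι)⁻¹) ^ m * (Measure.pi fun _ : ι => μ).real (piPrimePowBall F ι 0) := by
  have key : (((residueFieldCard F : ℝ)⁻¹) ^ m) ^ Fintype.card ι = (((residueFieldCard F : ℝ) ^ Fintype.card ι)⁻¹) ^ m := by
    rw [← zpow_natCast, ← _root_.zpow_mul, mul_comm, _root_.zpow_mul, zpow_natCast, inv_pow]
  rw [measureReal_piPrimePowBall_pi μ m, measureReal_piPrimePowBall_pi μ 0, zpow_zero, one_mul, mul_pow, key]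

variable [MeasurableSpace (ι → F)] in
omit [MeasurableSpace F] [BorelSpace F] in
/-- `‖1_{(𝔭^m)^ι}‖²_{L²(ν)} = ν((𝔭^m)^ι)` for any measure `ν` on `F^ι` for which the box is measurable.
[cite: WeilBNT1967, Ch. II §2, Prop. 4] -/
theorem l2NormSq_piBallSB (ν : Measure (ι → F)) (m : ℤ) (hm : MeasurableSet (piPrimePowBall F ι m)) :
    l2NormSq ν (piBallSB F ι m) = ν (piPrimePowBall F ι m) := by
  rw [l2NormSq_def, coe_piBallSB, ← lintegral_indicator_one hm]
  refine lintegral_congr fun x => ?_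
  by_cases hx : x ∈ piPrimePowBall F ι m
  · simp [Set.indicator_of_mem hx]
  · simp [Set.indicator_of_notMem hx]

end Boxes

section BoxesPi

variable {F : Type*} [Field F] [ValuativeRel F] [TopologicalSpace F] [IsNonarchimedeanLocalField F]
  {ι : Type*} [Fintype ι] [MeasurableSpace F] [BorelSpace F] (μ : Measure F) [μ.IsAddHaarMeasure]

/-- boxes are measurable for the product σ-algebra. [cite: WeilBNT1967, Ch. II §2, Def. 2] -/
theorem measurableSet_piPrimePowBall_pi (m : ℤ) :
    MeasurableSet[MeasurableSpace.pi] (piPrimePowBall F ι m) :=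
  MeasurableSet.univ_pi fun _ => measurableSet_primePowBall m

omit [μ.IsAddHaarMeasure] in
/-- `‖1_{(𝔭^m)^ι}‖²_{L²(μ^ι)} = μ^ι((𝔭^m)^ι)`. [cite: WeilBNT1967, Ch. II §2, Prop. 4] -/
theorem l2NormSq_piBallSB_pi (m : ℤ) :
    l2NormSq (Measure.pi fun _ : ι => μ) (piBallSB F ι m) = (Measure.pi fun _ : ι => μ) (piPrimePowBall F ι m) :=
  l2NormSq_piBallSB _ m (measurableSet_piPrimePowBall_pi (F := F) (ι := ι) m)

omit [μ.IsAddHaarMeasure] in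
/-- **`⟨1_{(𝔭^m)^ι}, 1_{𝒪^ι}⟩ = μ^ι((𝔭^{max(m,0)})^ι)`** (`⟨Φ, Ψ⟩ = ∫ Φ Ψ̄`; the boxes are nested).
[cite: WeilBNT1967, Ch. II §2, Prop. 4] -/
theorem integral_piBallSB_mul_conj_integersIndicator (Φ₀ : SchwartzBruhat (ι → F))
    (hΦ₀ : (Φ₀ : (ι → F) → ℂ) = (piPrimePowBall F ι 0).indicator fun _ => (1 : ℂ)) (m : ℤ) :
    ∫ x, ((piBallSB F ι m : SchwartzBruhat (ι → F)) : (ι → F) → ℂ) x * conj ((Φ₀ : (ι → F) → ℂ) x)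
        ∂(Measure.pi fun _ : ι => μ) =
      ((Measure.pi fun _ : ι => μ).real (piPrimePowBall F ι (max m 0)) : ℂ) := by
  have hsub : piPrimePowBall F ι m ∩ piPrimePowBall F ι 0 = piPrimePowBall F ι (max m 0) := by
    rcases le_total m 0 with h | h
    · rw [max_eq_right h, Set.inter_eq_right.2 (piPrimePowBall_antitone h)]
    · rw [max_eq_left h, Set.inter_eq_left.2 (piPrimePowBall_antitone h)]
  have hpt : ∀ x, ((piBallSB F ι m : SchwartzBruhat (ι → F)) : (ι → F) → ℂ) x * conj ((Φ₀ : (ι → F) → ℂ) x) =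
      (piPrimePowBall F ι (max m 0)).indicator (fun _ => (1 : ℂ)) x := by
    intro x
    rw [coe_piBallSB, hΦ₀, ← hsub, ← Set.indicator_indicator]
    by_cases hx : x ∈ piPrimePowBall F ι m
    · rw [Set.indicator_of_mem hx, Set.indicator_of_mem hx]
      by_cases hx0 : x ∈ piPrimePowBall F ι 0
      · simp [Set.indicator_of_mem hx0]
      · simp [Set.indicator_of_notMem hx0]
    · rw [Set.indicator_of_notMem hx, Set.indicator_of_notMem hx, zero_mul]
  simp_rw [hpt]
  rw [integral_indicator_const _ (measurableSet_piPrimePowBall_pi (F := F) (ι := ι) _), Complex.real_smul, mul_one]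

end BoxesPi

/-! ## §2 The spherical matrix coefficients of a Darboux-conjugate torus, isometric implementers -/

section ConjugateTorusCoeff

variable {F : Type*} [Field F] [ValuativeRel F] [TopologicalSpace F] [IsNonarchimedeanLocalField F]
  {ι : Type*} [Fintype ι] [DecidableEq ι] [Invertible (2 : F)] (T : Matrix ι ι F) (hT : IsUnit T.det)
  {ψ : AddChar F Circle} (hl : IsLocallyConstant (⇑ψ : F → Circle))
  (hbT : ∀ y : ι → F, Continuous fun u : ι → F => Matrix.toLinearMap₂' F T u y)
  (Φ₀ : SchwartzBruhat (ι → F))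
  (hΦ₀ : (Φ₀ : (ι → F) → ℂ) = (piPrimePowBall F ι 0).indicator fun _ => (1 : ℂ))
  [MeasurableSpace F] [BorelSpace F] (μ : Measure F) [μ.IsAddHaarMeasure]

/-- scalar bookkeeping: if `M f = c • N f` for all `f` then `M^j f = c^j • N^j f` for all `j ∈ ℤ`. [folklore] -/
private theorem zpow_apply_eq_smul_of_apply_eq_smul {S : Type*} [AddCommGroup S] [Module ℂ S] {M N : S ≃ₗ[ℂ] S} {c : ℂˣ}
    (h : ∀ f, M f = (c : ℂ) • N f) (j : ℤ) (f : S) : (M ^ j) f = ((c ^ j : ℂˣ) : ℂ) • (N ^ j) f := by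
  have hinv : ∀ f, M⁻¹ f = ((c⁻¹ : ℂˣ) : ℂ) • N⁻¹ f := by
    intro f
    have h1 : M (((c⁻¹ : ℂˣ) : ℂ) • N⁻¹ f) = f := by
      rw [map_smul, h, smul_smul, Units.val_inv_eq_inv_val, inv_mul_cancel₀ c.ne_zero, one_smul, ← LinearEquiv.mul_apply,
        mul_inv_cancel, LinearEquiv.coe_one, id_eq]
    apply M.injective
    rw [h1, LinearEquiv.coe_inv, LinearEquiv.apply_symm_apply]
  induction j using Int.induction_on generalizing f with
  | zero => simp
  | succ n ih =>
    rw [_root_.zpow_add_one M, _root_.zpow_add_one N, zpow_add_one c, LinearEquiv.mul_apply, LinearEquiv.mul_apply, h, map_smul, ih,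
      smul_smul, Units.val_mul, mul_comm]
  | pred n ih =>
    rw [_root_.zpow_sub_one M, _root_.zpow_sub_one N, zpow_sub_one c, LinearEquiv.mul_apply, LinearEquiv.mul_apply, hinv, map_smul, ih,
      smul_smul, Units.val_mul, mul_comm]

include hT μ hΦ₀ in
/-- **THE SPHERICAL MATRIX COEFFICIENTS OF A DARBOUX-CONJUGATE TORUS.**  Let `γ = transportSp T (A)`, `A ∈ Sp_{2ι}(𝒪)`, have an
`L²(μ^ι)`-ISOMETRIC implementer `Γ` (model `ρ_T`; `T`, `ψ` unramified, `2 ∈ 𝒪^×`, implementers unique up to scalars), let `ϖ` be a uniformiser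
and `M` an `L²(μ^ι)`-ISOMETRIC implementer of the conjugate torus element `γ⁻¹ m(ϖ·1) γ`.  Then there is `u ∈ ℂ` with `|u| = 1` such that
for every `j ∈ ℤ`: `∫ (M^j 1_{𝒪^ι}) conj 1_{𝒪^ι} dμ^ι = μ^ι(𝒪^ι) · u^j · ((q^{#ι})^{1/2})^{-|j|}` — the input `hcoef` of the split-place
unramified local factor (`Li1992/RallisLocalFactorSplitUnramified`).
[cite: MoeglinVignerasWaldspurger1987, Chap. 2 II.1 (A), II.6, II.10; GelbartRogawski1991, §3.2 p. 457; Weil1964, Chap. I n° 13] -/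
theorem exists_unit_integral_zpow_apply_integersIndicator_mul_conj (hψ : ψ.IsContinuousNontrivial) (hm0 : ψ.HasConductorExp 0)
    (h2 : (⅟(2 : F) : F) ∈ primePowBall F 0)
    (hU : ImplementerUniqueUpToScalar (schrodingerSB (Matrix.toLinearMap₂' F T) ψ hl hbT))
    (A : Matrix.symplecticGroup ι 𝒪[F]) {Γ : SchwartzBruhat (ι → F) ≃ₗ[ℂ] SchwartzBruhat (ι → F)}
    (hΓ : Implements (schrodingerSB (Matrix.toLinearMap₂' F T) ψ hl hbT)
      (ofSymplectic _ (transportSp T hT (mapHom (Valuation.integer (valuation F)).subtype A))) Γ)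
    (hΓiso : ∀ Φ, l2NormSq (Measure.pi fun _ : ι => μ) (Γ Φ) = l2NormSq (Measure.pi fun _ : ι => μ) Φ)
    {t : F} (ht : normAbs F t = (residueFieldCard F : ℝ≥0)⁻¹) {a₀ : GL ι F}
    (ha₀ : (a₀ : Matrix ι ι F) = t • (1 : Matrix ι ι F))
    {M : SchwartzBruhat (ι → F) ≃ₗ[ℂ] SchwartzBruhat (ι → F)}
    (hM : Implements (schrodingerSB (Matrix.toLinearMap₂' F T) ψ hl hbT)
      (ofSymplectic _ ((transportSp T hT (mapHom (Valuation.integer (valuation F)).subtype A))⁻¹ *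
        transportSp T hT (levi a₀) * transportSp T hT (mapHom (Valuation.integer (valuation F)).subtype A))) M)
    (hMiso : ∀ Φ, l2NormSq (Measure.pi fun _ : ι => μ) (M Φ) = l2NormSq (Measure.pi fun _ : ι => μ) Φ) :
    ∃ u : ℂ, ‖u‖ = 1 ∧ ∀ j : ℤ,
      ∫ x, (((M ^ j) Φ₀ : SchwartzBruhat (ι → F)) : (ι → F) → ℂ) x * conj ((Φ₀ : (ι → F) → ℂ) x) ∂(Measure.pi fun _ : ι => μ) =
        ((Measure.pi fun _ : ι => μ).real (piPrimePowBall F ι 0) : ℂ) * u ^ j *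
          (((Real.sqrt ((residueFieldCard F : ℝ) ^ Fintype.card ι))⁻¹ : ℝ) : ℂ) ^ j.natAbs := by
  classical
  haveI : SecondCountableTopology F := secondCountableTopology_localField F
  set ν : Measure (ι → F) := Measure.pi fun _ : ι => μ with hν
  -- (1) the unramified eigenvector: `Γ 1 = cΓ • 1`, and `|cΓ| = 1` since `Γ` is isometric
  obtain ⟨cΓ, hcΓ⟩ := exists_smul_integersIndicator_of_implements T hT hl hbT _ integer_subtype_mem Φ₀ hΦ₀
    continuous_dotProductBilin_left μ hψ hm0 h2 hU A hΓ
  have hΦ₀ne : Φ₀ ≠ 0 := by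
    intro h0
    have h1 := congrArg (fun Φ : SchwartzBruhat (ι → F) => (Φ : (ι → F) → ℂ) 0) h0
    simp only [hΦ₀, ZeroMemClass.coe_zero, Pi.zero_apply, Set.indicator_of_mem (zero_mem_piPrimePowBall (F := F) (ι := ι) 0),
      one_ne_zero] at h1
  have hn0 : l2NormSq ν Φ₀ ≠ 0 := (l2NormSq_pos ν hΦ₀ne).ne'
  have hntop : l2NormSq ν Φ₀ ≠ ∞ := l2NormSq_ne_top ν Φ₀
  have hcΓ1 : ‖(cΓ : ℂ)‖ = 1 := by
    have h1 : ‖(cΓ : ℂ)‖ₑ ^ 2 * l2NormSq ν Φ₀ = 1 * l2NormSq ν Φ₀ := by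
      rw [one_mul, ← l2NormSq_smul, ← hcΓ, hΓiso]
    have h2' : ‖(cΓ : ℂ)‖ₑ ^ 2 = 1 := (ENNReal.mul_left_inj hn0 hntop).1 h1
    have h3 := congrArg ENNReal.toReal h2'
    rw [ENNReal.toReal_pow, ← ofReal_norm, ENNReal.toReal_ofReal (norm_nonneg _), ENNReal.toReal_one] at h3
    exact (pow_eq_one_iff_of_nonneg (norm_nonneg _) two_ne_zero).1 h3
  -- (2) the Levi operator `L` of `m(ϖ·1)`: `L^j 1 = 1_{𝔭^j}`
  obtain ⟨L, hL, hLj⟩ : ∃ L : SchwartzBruhat (ι → F) ≃ₗ[ℂ] SchwartzBruhat (ι → F),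
      Implements (schrodingerSB (Matrix.toLinearMap₂' F T) ψ hl hbT) (ofSymplectic _ (transportSp T hT (levi a₀))) L ∧
        ∀ j : ℤ, (L ^ j) Φ₀ = piBallSB F ι j :=
    ⟨_, implements_transportSp_levi T hT hl hbT a₀, fun j => zpow_leviEquivSB_scalar_integersIndicator ht ha₀ Φ₀ hΦ₀ j⟩
  -- (3) `N = Γ⁻¹ L Γ` implements the conjugate torus element; `M = c • N` by uniqueness; `M^j = c^j N^j`
  set γ := transportSp T hT (mapHom (Valuation.integer (valuation F)).subtype A) with hγ_def
  have hN : Implements (schrodingerSB (Matrix.toLinearMap₂' F T) ψ hl hbT)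
      (ofSymplectic _ (γ⁻¹ * transportSp T hT (levi a₀) * γ)) (Γ⁻¹ * L * Γ) := by
    rw [map_mul, map_mul, map_inv]
    exact Implements.mul _ (Implements.mul _ (Implements.inv _ hΓ) hL) hΓ
  obtain ⟨c, hc⟩ := hU _ _ _ hN hM
  have hMj : ∀ (j : ℤ) (f : SchwartzBruhat (ι → F)), (M ^ j) f = ((c ^ j : ℂˣ) : ℂ) • ((Γ⁻¹ * L * Γ) ^ j) f :=
    zpow_apply_eq_smul_of_apply_eq_smul hc
  have hconj : ∀ j : ℤ, (Γ⁻¹ * L * Γ) ^ j = Γ⁻¹ * L ^ j * Γ := fun j => by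
    have h := conj_zpow (a := Γ⁻¹) (b := L) (i := j)
    rwa [inv_inv] at h
  -- `N^j 1 = cΓ • Γ⁻¹ 1_{𝔭^j}`
  have hNj : ∀ j : ℤ, (((Γ⁻¹ * L * Γ) ^ j) Φ₀ : SchwartzBruhat (ι → F)) = (cΓ : ℂ) • Γ.symm (piBallSB F ι j) := fun j => by
    rw [hconj, LinearEquiv.mul_apply, LinearEquiv.mul_apply, LinearEquiv.coe_inv, hcΓ, map_smul, hLj, map_smul]
  -- (4) `Γ⁻¹` preserves the pairing; `Γ⁻¹ 1 = cΓ⁻¹ • 1`, `conj cΓ⁻¹ = cΓ`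
  have hΓsymm1 : Γ.symm Φ₀ = ((cΓ⁻¹ : ℂˣ) : ℂ) • Φ₀ := by
    have h := congrArg Γ.symm hcΓ
    rw [Γ.symm_apply_apply, map_smul] at h
    rw [Units.val_inv_eq_inv_val, eq_inv_smul_iff₀ cΓ.ne_zero, ← h]
  have hconjinv : conj (((cΓ⁻¹ : ℂˣ) : ℂ)) = (cΓ : ℂ) := by
    rw [Units.val_inv_eq_inv_val, map_inv₀, ← Complex.inv_eq_conj hcΓ1, inv_inv]
  have hpair : ∀ j : ℤ, (cΓ : ℂ) * ∫ x, ((Γ.symm (piBallSB F ι j) : SchwartzBruhat (ι → F)) : (ι → F) → ℂ) x *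
      conj ((Φ₀ : (ι → F) → ℂ) x) ∂ν = ((ν.real (piPrimePowBall F ι (max j 0)) : ℂ)) := by
    intro j
    have h := integral_mul_conj_symm_eq_of_l2NormSq_eq ν Γ hΓiso (piBallSB F ι j) Φ₀
    rw [integral_piBallSB_mul_conj_integersIndicator μ Φ₀ hΦ₀ j, hΓsymm1] at h
    rw [← h, ← integral_const_mul]
    refine integral_congr_ae (Filter.Eventually.of_forall fun x => ?_)
    simp only [Submodule.coe_smul, Pi.smul_apply, smul_eq_mul, map_mul, hconjinv]
    ring
  -- (5) the coefficient: `∫ (M^j 1) conj 1 = c^j · ν((𝔭^{max(j,0)})^ι)`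
  have hcoefc : ∀ j : ℤ, ∫ x, (((M ^ j) Φ₀ : SchwartzBruhat (ι → F)) : (ι → F) → ℂ) x * conj ((Φ₀ : (ι → F) → ℂ) x) ∂ν =
      ((c : ℂ) ^ j) * ((ν.real (piPrimePowBall F ι (max j 0)) : ℂ)) := by
    intro j
    rw [← hpair j, ← integral_const_mul, ← integral_const_mul]
    refine integral_congr_ae (Filter.Eventually.of_forall fun x => ?_)
    simp only [hMj j, hNj j, Submodule.coe_smul, Pi.smul_apply, smul_eq_mul, Units.val_zpow_eq_zpow_val]
    ring
  -- (6) `|c|² = q^{#ι}` from the isometry of `M` (and of `Γ⁻¹`)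
  have hΓsymm_iso : ∀ Φ, l2NormSq ν (Γ.symm Φ) = l2NormSq ν Φ := fun Φ => by
    rw [← hΓiso (Γ.symm Φ), Γ.apply_symm_apply]
  have hbox : ∀ m : ℤ, ν.real (piPrimePowBall F ι m) =
      (((residueFieldCard F : ℝ) ^ Fintype.card ι)⁻¹) ^ m * ν.real (piPrimePowBall F ι 0) :=
    measureReal_piPrimePowBall_pi_eq_zpow_mul μ
  have hq : 0 < (residueFieldCard F : ℝ) ^ Fintype.card ι :=
    pow_pos (Nat.cast_pos.2 (Nat.pos_of_ne_zero (residueFieldCard_ne_zero F))) _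
  have hbox0 : 0 < ν.real (piPrimePowBall F ι 0) := measureReal_piPrimePowBall_pos ν 0
  have hΦ₀eq : (Φ₀ : SchwartzBruhat (ι → F)) = piBallSB F ι 0 := Subtype.ext (by rw [hΦ₀, coe_piBallSB])
  have hnormc : ‖(c : ℂ)‖ ^ 2 = (residueFieldCard F : ℝ) ^ Fintype.card ι := by
    -- `‖M 1‖² = ‖c‖² ‖cΓ‖² ‖Γ⁻¹ 1_𝔭‖² = ‖c‖² ν(𝔭 box)`, and `‖M 1‖² = ‖1‖² = ν(𝒪 box)`
    have h1 : l2NormSq ν (M Φ₀) = ‖(c : ℂ)‖ₑ ^ 2 * ν (piPrimePowBall F ι 1) := by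
      have e : M Φ₀ = ((c : ℂ) * (cΓ : ℂ)) • Γ.symm (piBallSB F ι 1) := by
        rw [hc, ← zpow_one (Γ⁻¹ * L * Γ), hNj 1, smul_smul]
      rw [e, l2NormSq_smul, hΓsymm_iso, l2NormSq_piBallSB_pi μ 1, enorm_mul, mul_pow,
        show ‖(cΓ : ℂ)‖ₑ ^ 2 = 1 by rw [← ofReal_norm, hcΓ1, ENNReal.ofReal_one, one_pow], mul_one]
    rw [hMiso, hΦ₀eq, l2NormSq_piBallSB_pi μ 0] at h1
    -- pass to reals: `ν₀ = ‖c‖² · ((q^ι)⁻¹ · ν₀)`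
    have h2 := congrArg ENNReal.toReal h1
    rw [ENNReal.toReal_mul, ENNReal.toReal_pow, ← ofReal_norm, ENNReal.toReal_ofReal (norm_nonneg _), ← measureReal_def,
      ← measureReal_def, hbox 1, zpow_one] at h2
    have hQ0 : ((residueFieldCard F : ℝ) ^ Fintype.card ι) ≠ 0 := hq.ne'
    have h3 : ‖(c : ℂ)‖ ^ 2 * ν.real (piPrimePowBall F ι 0) =
        (residueFieldCard F : ℝ) ^ Fintype.card ι * ν.real (piPrimePowBall F ι 0) := by
      calc ‖(c : ℂ)‖ ^ 2 * ν.real (piPrimePowBall F ι 0)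
          = ‖(c : ℂ)‖ ^ 2 * ((((residueFieldCard F : ℝ) ^ Fintype.card ι)⁻¹) * ν.real (piPrimePowBall F ι 0)) *
              (residueFieldCard F : ℝ) ^ Fintype.card ι := by field_simp
        _ = ν.real (piPrimePowBall F ι 0) * (residueFieldCard F : ℝ) ^ Fintype.card ι := by rw [← h2]
        _ = _ := mul_comm _ _
    exact mul_right_cancel₀ hbox0.ne' h3
  -- (7) `u := c / ‖c‖`
  set R : ℝ := Real.sqrt ((residueFieldCard F : ℝ) ^ Fintype.card ι) with hR
  have hR0 : 0 < R := Real.sqrt_pos.2 hq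
  have hRsq : R ^ 2 = (residueFieldCard F : ℝ) ^ Fintype.card ι := Real.sq_sqrt hq.le
  have hcnorm : ‖(c : ℂ)‖ = R := by
    rw [hR, ← hnormc, Real.sqrt_sq (norm_nonneg _)]
  have hc0 : (c : ℂ) ≠ 0 := c.ne_zero
  refine ⟨(c : ℂ) / R, ?_, fun j => ?_⟩
  · rw [norm_div, Complex.norm_real, Real.norm_eq_abs, abs_of_pos hR0, hcnorm, div_self hR0.ne']
  have hRC : (R : ℂ) ≠ 0 := Complex.ofReal_ne_zero.2 hR0.ne'
  -- `c^j (R²)⁻ᵐᵃˣ⁽ʲ'⁰⁾ = (c/R)^j (R⁻¹)^{|j|}`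
  have key : (c : ℂ) ^ j * (((R : ℂ) ^ 2)⁻¹) ^ (max j 0) = ((c : ℂ) / R) ^ j * ((R : ℂ)⁻¹) ^ j.natAbs := by
    rcases le_or_gt 0 j with hj | hj
    · obtain ⟨n, rfl⟩ := Int.eq_ofNat_of_zero_le hj
      rw [max_eq_left hj, Int.natAbs_natCast, zpow_natCast, zpow_natCast, zpow_natCast, ← mul_pow, ← mul_pow]
      congr 1
      field_simp
    · obtain ⟨n, hn⟩ := Int.exists_eq_neg_ofNat hj.le
      subst hn
      rw [max_eq_right hj.le, zpow_zero, mul_one, Int.natAbs_neg, Int.natAbs_natCast, _root_.zpow_neg, _root_.zpow_neg, zpow_natCast,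
        zpow_natCast, div_pow, inv_pow, inv_div, div_eq_mul_inv, mul_comm, ← mul_assoc, inv_mul_cancel₀ (pow_ne_zero n hRC), one_mul]
  rw [hcoefc j, hbox (max j 0), ← hRsq]
  push_cast
  calc (c : ℂ) ^ j * ((((R : ℂ) ^ 2)⁻¹) ^ max j 0 * ((ν.real (piPrimePowBall F ι 0) : ℝ) : ℂ))
      = ((ν.real (piPrimePowBall F ι 0) : ℝ) : ℂ) * ((c : ℂ) ^ j * (((R : ℂ) ^ 2)⁻¹) ^ max j 0) := by ring
    _ = ((ν.real (piPrimePowBall F ι 0) : ℝ) : ℂ) * (((c : ℂ) / R) ^ j * ((R : ℂ)⁻¹) ^ j.natAbs) := by rw [key]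
    _ = _ := by ring


include hT μ hΦ₀ in
/-- **COORDINATE-FREE FORM, ISOMETRIC `Γ` SUPPLIED**: for any `γ ∈ Sp(W, A_T)` preserving the self-dual lattice `𝒪^ι × 𝒪^ι` (`T, T⁻¹` integral),
a uniformiser `ϖ` and an `L²(μ^ι)`-ISOMETRIC implementer `M` of `γ⁻¹ m(ϖ·1) γ`: there is `u ∈ ℂ`, `|u| = 1`, with
`∫ (M^j 1_{𝒪^ι}) conj 1_{𝒪^ι} dμ^ι = μ^ι(𝒪^ι) · u^j · ((√(q^{#ι}))⁻¹)^{|j|}` for all `j ∈ ℤ` (`γ = transportSp T (A)`, `A ∈ Sp_{2ι}(𝒪)` by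
★ `exists_eq_transportSp_mapHom_of_mapsTo`; an isometric implementer of `γ` exists by ★ `exists_isometric_implementer_gram`; uniqueness of
implementers ★ `implementerUniqueUpToScalar_schrodingerSB_gram`).  The shape consumed at a split place (`γ = splitDarboux`).
[cite: MoeglinVignerasWaldspurger1987, Chap. 2 II.1 (A), II.6, II.10; GelbartRogawski1991, §3.2 p. 457; Weil1964, Chap. I n° 13] -/
theorem exists_unit_integral_zpow_apply_integersIndicator_mul_conj_of_mapsTo (hψ : ψ.IsContinuousNontrivial)
    (hm0 : ψ.HasConductorExp 0) (h2 : (⅟(2 : F) : F) ∈ primePowBall F 0)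
    (hTi : ∀ i j, T i j ∈ primePowBall F 0) (hTi' : ∀ i j, T⁻¹ i j ∈ primePowBall F 0)
    (γ : symplecticGroup (polar (Matrix.toLinearMap₂' F T)))
    (hγ : ∀ v ∈ (piPrimePowBall F ι 0) ×ˢ (piPrimePowBall F ι 0),
      (γ : ((ι → F) × (ι → F)) ≃ₗ[F] ((ι → F) × (ι → F))) v ∈ (piPrimePowBall F ι 0) ×ˢ (piPrimePowBall F ι 0))
    {t : F} (ht : normAbs F t = (residueFieldCard F : ℝ≥0)⁻¹) {a₀ : GL ι F}
    (ha₀ : (a₀ : Matrix ι ι F) = t • (1 : Matrix ι ι F))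
    {M : SchwartzBruhat (ι → F) ≃ₗ[ℂ] SchwartzBruhat (ι → F)}
    (hM : Implements (schrodingerSB (Matrix.toLinearMap₂' F T) ψ hl hbT)
      (ofSymplectic _ (γ⁻¹ * transportSp T hT (levi a₀) * γ)) M)
    (hMiso : ∀ Φ, l2NormSq (Measure.pi fun _ : ι => μ) (M Φ) = l2NormSq (Measure.pi fun _ : ι => μ) Φ) :
    ∃ u : ℂ, ‖u‖ = 1 ∧ ∀ j : ℤ,
      ∫ x, (((M ^ j) Φ₀ : SchwartzBruhat (ι → F)) : (ι → F) → ℂ) x * conj ((Φ₀ : (ι → F) → ℂ) x) ∂(Measure.pi fun _ : ι => μ) =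
        ((Measure.pi fun _ : ι => μ).real (piPrimePowBall F ι 0) : ℂ) * u ^ j *
          (((Real.sqrt ((residueFieldCard F : ℝ) ^ Fintype.card ι))⁻¹ : ℝ) : ℂ) ^ j.natAbs := by
  haveI : SecondCountableTopology F := secondCountableTopology_localField F
  obtain ⟨A, rfl⟩ := exists_eq_transportSp_mapHom_of_mapsTo T hT hTi hTi' γ hγ
  obtain ⟨Γ, hΓ, hΓiso⟩ := exists_isometric_implementer_gram T hT hl hbT μ hψ hm0
    (transportSp T hT (mapHom (Valuation.integer (valuation F)).subtype A))
  exact exists_unit_integral_zpow_apply_integersIndicator_mul_conj T hT hl hbT Φ₀ hΦ₀ μ hψ hm0 h2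
    (implementerUniqueUpToScalar_schrodingerSB_gram T hT hl hbT hψ) A hΓ hΓiso ht ha₀ hM hMiso

end ConjugateTorusCoeff

end Literature.RepresentationTheory.HeisenbergGroup

end
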